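import Summits.QuantumFields.BalabanUV.Beta.CombMixedT2EvenStoreyTwoPeriodised

/-!
# `BalabanUV.Beta.CombMixedT2EvenStoreyTwoCopies` — binder row D1 ∕ (C1), PART 31b: **THE TORUS CONTRACTION IS THE LATTICE CONTRACTION; THE COMPOSITE AT A COPY OF THE COARSE
# BOND IS THE BLOCK TRANSLATE OF THE COMPOSITE AT THE ORIGINAL** — the generic first half of an2's period-lattice engine, the joint period covariance of both storey words of
# PART 30∕31a (`M = Lc²·M′`: `Lc•Lc•(M′∘n) = M∘n`), and the decoupling of a double period sum of a two-window function into a finite double sum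

WHY (J-NOTE-14 §5; PART 31a `CombMixedT2EvenStoreyTwoPeriodised`; consumed by PART 31c `CombMixedT2EvenStoreyTwoTorus`).  At depth 2 the lattice Ward row of the even composite mixed
table (PART 30) is a two-storey word, not the engine's single-commutator `hlaw`; so the torus row is assembled by hand: (§4) the torus insertion of a torus pure gauge is the LATTICE
contraction with the periodic indicator `δ_s` (an2 g42 `CombWilsonT2Periodised.sum_tgrad_mul_dper_of_indexLaw_periodCov` stopped before `hlaw`), periodised in the right slot;
(§5) PART 31a §3's two storey words at the copy `w + M′∘n` of the coarse bond equal those at `w` read at the fluctuation pair shifted by `−M∘n` (an1's `symLinKerAt_add ∕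
symHessKerAt_add` at both levels) — so the whole row is `perZ M ∘ dper M` of ONE lattice kernel; (§6) such a double period sum of a function supported in a finite window in each
fluctuation site is a finite decoupled double sum (`k = m + n`).

WHAT ([folklore] `tsum` re-indexing BY NAME; no `def`, no `def … : Prop`, nothing cited, 0 sorry):
* §4 (generic `d`, any family `V` with period-lattice covariance `hVt` and finite windows `hT ∕ hS`): **`sum_tgrad_mul_dper_eq_tsum_of_periodCov`**
  (`Σ_{u ∈ pbox M} Σ_κ tgrad M (u, inl κ) s · dper M (V κ u) x z a b = Σ'_u Σ_κ (δ_s(u+e_κ) − δ_s u)·V κ u x z a b`), **`sum_tgrad_mul_perZ_dper_eq_tsum_of_periodCov`** (`perZ` on top: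
  `= Σ'_m Σ'_u Σ_κ (…)·V κ u x (z + M∘m) a b`).
* §5 (`d = 3`, centred root, `hM : M = Lc²·M′`): `smul_translate_add`, `translate_neg_add_smul_smul`, **`symLinKerAt_copy`** (`ℓ(κ₁, Lc•(w+M′∘n)+e₁; (ξ,x)) = ℓ(κ₁, Lc•w+e₁; (ξ, x−M∘n))`),
  **`symHessKerAt_top_copy`**, **`symLinKerAt_top_copy`**, **`symHessKerAt_low_copy`**, **`root_copy`** (`Lc•(Lc•(w+M′∘n)+e)+ρ_c = (Lc•(Lc•w+e)+ρ_c) + M∘n`).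
* §6 `not_near_of_not_mem_window₂` (PART 30's `hfar`: the fine window of a coarse bond is `⋃_{e ∈ offs} Near Lc (Lc•w+e)`), and the generic (any `d`) **`tsum_tsum_translate_eq_sum_sum`**:
  `Σ'_m Σ'_n F (x+M∘n) (z+M∘m+M∘n) = Σ_{n ∈ Nx} Σ_{k ∈ Nz} F (x+M∘n) (z+M∘k)` whenever `F (x+M∘n) · = 0` off `Nx` and `F · (z+M∘k) = 0` off `Nz`.
WHAT THIS IS NOT: not the torus row (PART 31c∕d); nothing of Bałaban's asserted, valued or discharged; 0 estimates; 0∕4 row-D1 binders (hW, hR, D1Tel, D1Rep); ROOT M‴ p325680 ∕ P5c ∕ D6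
untouched; NOT (C1), NOT (T-ID), NOT D1, NEVER «G-an2-4 closed», NOT BetaPertH, NOT continuum, NOT Clay.

HONEST DEPENDENCY (page 1, mandatory): continuum YM on T⁴ ⇐ BetaPertH ∧ nine spine estimates (0/9 proved); BetaPertH ⇐ (D1) ∧ (D4) ∧ CAP+tail;
G-an2-4 gates asym, D1 and NE2/3/4.  HONEST FRAMING (cell contract, verbatim): «discharging `BetaPertH` makes Bałaban's UV stability UNCONDITIONAL —
a real constructive-QFT result; it is NOT the continuum limit and NOT the Clay problem.»  ABSOLUTE RULE (cell charter, verbatim): «No internally-minted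
statement may enter as a cited fact. Every hypothesis is either kernel-proved in this package or a verbatim quotation of a PUBLISHED theorem with page
reference. The manuscript(s) under audit are NOT citable for their own disputed steps — they are the thing under adjudication; programme-internal
(2001/route/tribunal) claims are never citable.»  Row D1 ∕ (C1) OWNER an2 (b2b-balaban-beta-an2) gen 71, 2026-08-28.  §4 adapted from an2 g42 `CombWilsonT2Periodised` §1 (same
proof, stopped before `hlaw`).  No existing file touched.
-/

noncomputable section

open scoped BigOperators

namespace Summit.QuantumFields.BalabanUV.Beta.CombMixedT2EvenStoreyTwoCopies

open Finset Matrix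
open Literature.MathematicalPhysics.QuantumFieldTheory
open Literature.MathematicalPhysics.QuantumFieldTheory.Balaban1983to89
open Literature.MathematicalPhysics.QuantumFieldTheory.Balaban1983to89.Beta
open B4TorusKernel.MultiPeriod (translate translate_apply)
open B4Reflection242 (translate_translate)
open B6Lemma24Torus (pbox mem_pbox)
open ExpKernelCalculus (MKer shiftK)
open AffineAveraging (Site box toSite unitVec dz)
open AveragingContoursRooted (ctr ctrOff ctrOff_mem_box)
open AveragingHessianKernels (Bond Near)
open OneStepResolventKernel (Fib)
open BalabanStepW2 (M2Of wM2)
open Summit.QuantumFields.BalabanUV.Beta.TameKernelCalculus (trK)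
open Summit.QuantumFields.BalabanUV.Beta.BorderedHessian (sgnK)
open Summit.QuantumFields.BalabanUV.Beta.AxialDressingRooted (cube mem_cube one_le_of_neZero)
open Summit.QuantumFields.BalabanUV.Beta.SymAveragingHessianCounts (symLinKerAt symHessKerAt symHessFFAt symHessFFAt_inl_inl symLinKerAt_eq_zero symLinKerAt_add
  symHessKerAt_add symHessKerAt_eq_zero_left symHessKerAt_eq_zero_right)
open Summit.QuantumFields.BalabanUV.Beta.CompositeVertexKernelRec (offs near_iff_exists_offs)
open Summit.QuantumFields.BalabanUV.Beta.CompositeOneShotJets (compMix)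
open Summit.QuantumFields.BalabanUV.Beta.FP.KernelPeriodisationFib (Idx perF perF_apply perZ perZ_apply perZ_smul translate_eq_add)
open Summit.QuantumFields.BalabanUV.Beta.FP.KernelPeriodisationFibLoc (dper dper_apply)
open Summit.QuantumFields.BalabanUV.Beta.FP.TorusGaugeCovariance (tdelta tdelta_translate tgrad tgrad_inl)
open Summit.QuantumFields.BalabanUV.Beta.FP.TorusGaugeCovariancePairing (sum_tdelta_mul wrapPt wrapPt_of_mem)
open Summit.QuantumFields.BalabanUV.Beta.FP.PeriodisedBorderIndexWard (translate_injective)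
open Summit.QuantumFields.BalabanUV.Beta.FP.PeriodisedBorderTables (translate_eq_add_smul)
open Summit.QuantumFields.BalabanUV.Beta.FP.KernelPeriodisationFibTrace (tsum_sites_eq_sum_tsum)
open Summit.QuantumFields.BalabanUV.Beta.CombWilsonT2Periodised (dper_apply_of_periodCov)

variable {Lc : ℕ} [NeZero Lc]

/-! ## §4 The period-lattice engine's first half, generic: the torus contraction IS the lattice contraction with the periodic indicator -/

section Generic

variable {d : ℕ} {M : Fin (d + 1) → ℕ} [∀ μ, NeZero (M μ)]
  (V : Fin (d + 1) → Site (d + 1) → MKer (d + 1) (Fib d)) (S T : Site (d + 1) → Finset (Site (d + 1))) (a b : Fib d)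

/-- [folklore] **THE TORUS INSERTION OF A TORUS PURE GAUGE IS THE LATTICE CONTRACTION WITH THE PERIODIC INDICATOR** (an2 g42's `sum_tgrad_mul_dper_of_indexLaw_periodCov`
stopped before the index law): for a family jointly invariant under the period lattice (`hVt`) with finite family support (`hT`),
`Σ_{u ∈ pbox M} Σ_κ tgrad M (u, inl κ) s · dper M (V κ u) x z a b = Σ'_u Σ_κ (δ_s(u+e_κ) − δ_s u)·V κ u x z a b`, `δ_s := tdelta M · s`. -/
theorem sum_tgrad_mul_dper_eq_tsum_of_periodCov
    (hVt : ∀ (κ : Fin (d + 1)) (u m x z : Site (d + 1)) (a b : Fib d),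
      V κ (translate M u m) (translate M x m) (translate M z m) a b = V κ u x z a b)
    (hT : ∀ (κ : Fin (d + 1)) (x z : Site (d + 1)), ∀ u ∉ T x, V κ u x z a b = 0)
    (s : ↥(pbox M)) (x z : Site (d + 1)) :
    ∑ u : ↥(pbox M), ∑ κ : Fin (d + 1), tgrad M (u, Sum.inl κ) s * dper M (V κ (u : Site (d + 1))) x z a b
      = ∑' u : Site (d + 1), ∑ κ : Fin (d + 1), dz (fun w => tdelta M w s) κ u * V κ u x z a b := by
  set H : Site (d + 1) → ℝ := fun u => ∑ κ, dz (fun w => tdelta M w s) κ u * V κ u x z a b with hH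
  have hHs : Summable H :=
    summable_of_ne_finset_zero (s := T x) fun u hu => Finset.sum_eq_zero fun κ _ => by rw [hT κ x z u hu, mul_zero]
  have hterm : ∀ (u : ↥(pbox M)) (κ : Fin (d + 1)),
      tgrad M (u, Sum.inl κ) s * dper M (V κ (u : Site (d + 1))) x z a b
        = ∑' m : Site (d + 1), dz (fun w => tdelta M w s) κ (translate M (u : Site (d + 1)) m) * V κ (translate M (u : Site (d + 1)) m) x z a b := fun u κ => by
    rw [dper_apply_of_periodCov V hVt κ (u : Site (d + 1)) x z a b, ← tsum_mul_left]
    refine tsum_congr fun m => ?_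
    congr 1
    simp only [tgrad_inl, dz]
    rw [show translate M (u : Site (d + 1)) m + unitVec κ = translate M ((u : Site (d + 1)) + unitVec κ) m by
        funext i; simp only [B4TorusKernel.MultiPeriod.translate_apply, Pi.add_apply]; ring, tdelta_translate, tdelta_translate]
  have hswap : ∀ u : ↥(pbox M), ∑ κ : Fin (d + 1), tgrad M (u, Sum.inl κ) s * dper M (V κ (u : Site (d + 1))) x z a b
      = ∑' m : Site (d + 1), H (translate M (u : Site (d + 1)) m) := fun u => by
    rw [Finset.sum_congr rfl fun κ _ => hterm u κ, ← Summable.tsum_finsetSum]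
    intro κ _
    exact summable_of_ne_finset_zero (s := (T x).preimage _ (translate_injective (M := M) (u : Site (d + 1))).injOn) fun m hm => by
      rw [hT κ x z _ (fun h => hm (Finset.mem_preimage.2 h)), mul_zero]
  rw [Finset.sum_congr rfl fun u _ => hswap u, ← tsum_sites_eq_sum_tsum M hHs, hH]

/-- [folklore] **… AND PERIODISED IN THE RIGHT FLUCTUATION SLOT**: with finite right-leg support (`hS`),
`Σ_{u ∈ pbox M} Σ_κ tgrad M (u, inl κ) s · perZ M (dper M (V κ u)) x z a b = Σ'_m Σ'_u Σ_κ (δ_s(u+e_κ) − δ_s u)·V κ u x (z + M∘m) a b`. -/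
theorem sum_tgrad_mul_perZ_dper_eq_tsum_of_periodCov
    (hVt : ∀ (κ : Fin (d + 1)) (u m x z : Site (d + 1)) (a b : Fib d),
      V κ (translate M u m) (translate M x m) (translate M z m) a b = V κ u x z a b)
    (hS : ∀ (κ : Fin (d + 1)) (u x : Site (d + 1)), ∀ z ∉ S x, V κ u x z a b = 0)
    (hT : ∀ (κ : Fin (d + 1)) (x z : Site (d + 1)), ∀ u ∉ T x, V κ u x z a b = 0)
    (s : ↥(pbox M)) (x z : Site (d + 1)) :
    ∑ u : ↥(pbox M), ∑ κ : Fin (d + 1), tgrad M (u, Sum.inl κ) s * perZ M (dper M (V κ (u : Site (d + 1)))) x z a b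
      = ∑' m : Site (d + 1), ∑' u : Site (d + 1), ∑ κ : Fin (d + 1), dz (fun w => tdelta M w s) κ u * V κ u x (translate M z m) a b := by
  have hdS : ∀ (κ : Fin (d + 1)) (u : Site (d + 1)), ∀ z' ∉ S x, dper M (V κ u) x z' a b = 0 := fun κ u z' hz' => by
    rw [dper_apply_of_periodCov V hVt κ u x z' a b]
    exact (tsum_congr fun m => hS κ _ x z' hz').trans tsum_zero
  have hsm : ∀ (u : ↥(pbox M)) (κ : Fin (d + 1)), Summable fun m : Site (d + 1) =>
      tgrad M (u, Sum.inl κ) s * dper M (V κ (u : Site (d + 1))) x (translate M z m) a b := fun u κ =>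
    summable_of_ne_finset_zero (s := (S x).preimage (fun m => translate M z m) (translate_injective (M := M) z).injOn) fun m hm => by
      rw [hdS κ _ _ (fun h => hm (Finset.mem_preimage.2 h)), mul_zero]
  have hper : ∀ (u : ↥(pbox M)) (κ : Fin (d + 1)),
      tgrad M (u, Sum.inl κ) s * perZ M (dper M (V κ (u : Site (d + 1)))) x z a b
        = ∑' m : Site (d + 1), tgrad M (u, Sum.inl κ) s * dper M (V κ (u : Site (d + 1))) x (translate M z m) a b := fun u κ => by
    rw [perZ_apply, tsum_mul_left]
  have h1 : ∀ u : ↥(pbox M), (∑ κ : Fin (d + 1), ∑' m : Site (d + 1), tgrad M (u, Sum.inl κ) s * dper M (V κ (u : Site (d + 1))) x (translate M z m) a b)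
      = ∑' m : Site (d + 1), ∑ κ : Fin (d + 1), tgrad M (u, Sum.inl κ) s * dper M (V κ (u : Site (d + 1))) x (translate M z m) a b := fun u =>
    (Summable.tsum_finsetSum fun κ _ => hsm u κ).symm
  simp only [hper, h1]
  rw [← Summable.tsum_finsetSum fun u _ => summable_sum fun κ _ => hsm u κ]
  exact tsum_congr fun m => sum_tgrad_mul_dper_eq_tsum_of_periodCov V T a b hVt hT s x (translate M z m)

end Generic

/-! ## §5 Copies of the coarse bond: both storey words are jointly period-covariant (`M = Lc²·M′`) -/

section Copies

variable {M M' : Fin (3 + 1) → ℕ} (w n : Site (3 + 1))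

omit [NeZero Lc] in
/-- [folklore] the level-1 bonds of the window of a copy are the `Lc•(M′∘n)`-shifts of those of the original: `Lc•(w + M′∘n) + e = (Lc•w + e) + Lc•(M′∘n)`. -/
theorem smul_translate_add (e : Site (3 + 1)) :
    (Lc : ℤ) • translate M' w n + e = ((Lc : ℤ) • w + e) + (Lc : ℤ) • (fun i => (M' i : ℤ) * n i) := by
  rw [translate_eq_add, smul_add]
  abel

omit [NeZero Lc] in
/-- [folklore] a fine site shifted back by a period vector of `M = Lc²·M′` and forward by `Lc•Lc•(M′∘n)` is itself. -/
theorem translate_neg_add_smul_smul (hM : ∀ i, M i = Lc ^ 2 * M' i) (x : Site (3 + 1)) :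
    translate M x (-n) + (Lc : ℤ) • ((Lc : ℤ) • fun i => (M' i : ℤ) * n i) = x := by
  rw [translate_eq_add_smul hM]
  funext i
  simp only [Pi.add_apply, Pi.smul_apply, Pi.neg_apply, smul_eq_mul, Nat.cast_pow]
  ring

omit [NeZero Lc] in
/-- [folklore] (TOP STOREY, transports) the finest linear brick at a level-1 bond of the COPY, read at a fine bond, is the brick at the original level-1 bond read at the fine bond
shifted back by the period vector (`symLinKerAt_add`): `ℓ(κ₁, Lc•(w+M′∘n)+e₁; (ξ, x)) = ℓ(κ₁, Lc•w+e₁; (ξ, x − M∘n))`. -/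
theorem symLinKerAt_copy (hM : ∀ i, M i = Lc ^ 2 * M' i) (κ₁ : Fin (3 + 1)) (e₁ : Site (3 + 1)) (ξ : Fin (3 + 1)) (x : Site (3 + 1)) :
    symLinKerAt (ctr 4 Lc) Lc κ₁ ((Lc : ℤ) • translate M' w n + e₁) (ξ, x) = symLinKerAt (ctr 4 Lc) Lc κ₁ ((Lc : ℤ) • w + e₁) (ξ, translate M x (-n)) := by
  rw [← symLinKerAt_add (ctr 4 Lc) Lc κ₁ ((Lc : ℤ) • w + e₁) ((Lc : ℤ) • fun i => (M' i : ℤ) * n i) (ξ, translate M x (-n)), smul_translate_add]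
  congr 1
  exact Prod.ext rfl (translate_neg_add_smul_smul n hM x).symm

omit [NeZero Lc] in
/-- [folklore] (TOP STOREY, brick) the level-1 Hessian brick of the COPY on the copy's window is the brick of the original (`symHessKerAt_add`). -/
theorem symHessKerAt_top_copy (ρ' : Fin (3 + 1)) (κ₁ : Fin (3 + 1)) (e₁ : Site (3 + 1)) (κ₂ : Fin (3 + 1)) (e₂ : Site (3 + 1)) :
    symHessKerAt (ctr 4 Lc) Lc ρ' (translate M' w n) (κ₁, (Lc : ℤ) • translate M' w n + e₁) (κ₂, (Lc : ℤ) • translate M' w n + e₂)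
      = symHessKerAt (ctr 4 Lc) Lc ρ' w (κ₁, (Lc : ℤ) • w + e₁) (κ₂, (Lc : ℤ) • w + e₂) := by
  rw [← symHessKerAt_add (ctr 4 Lc) Lc ρ' w (fun i => (M' i : ℤ) * n i) (κ₁, (Lc : ℤ) • w + e₁) (κ₂, (Lc : ℤ) • w + e₂), smul_translate_add, smul_translate_add,
    translate_eq_add]
  rfl

omit [NeZero Lc] in
/-- [folklore] (LOWER STOREY, weight) the level-1 linear brick of the COPY at the copy's window bond is that of the original (`symLinKerAt_add`). -/
theorem symLinKerAt_top_copy (ρ' : Fin (3 + 1)) (κ : Fin (3 + 1)) (e : Site (3 + 1)) :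
    symLinKerAt (ctr 4 Lc) Lc ρ' (translate M' w n) (κ, (Lc : ℤ) • translate M' w n + e) = symLinKerAt (ctr 4 Lc) Lc ρ' w (κ, (Lc : ℤ) • w + e) := by
  rw [← symLinKerAt_add (ctr 4 Lc) Lc ρ' w (fun i => (M' i : ℤ) * n i) (κ, (Lc : ℤ) • w + e), smul_translate_add, translate_eq_add]
  rfl

omit [NeZero Lc] in
/-- [folklore] (LOWER STOREY, brick) the finest Hessian brick at a level-1 bond of the COPY is the brick at the original bond read at the fluctuation pair shifted back by the
period vector (`symHessKerAt_add`). -/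
theorem symHessKerAt_low_copy (hM : ∀ i, M i = Lc ^ 2 * M' i) (κ : Fin (3 + 1)) (e : Site (3 + 1)) (ξ : Fin (3 + 1)) (x : Site (3 + 1)) (ξ' : Fin (3 + 1))
    (z : Site (3 + 1)) :
    symHessKerAt (ctr 4 Lc) Lc κ ((Lc : ℤ) • translate M' w n + e) (ξ, x) (ξ', z)
      = symHessKerAt (ctr 4 Lc) Lc κ ((Lc : ℤ) • w + e) (ξ, translate M x (-n)) (ξ', translate M z (-n)) := by
  rw [← symHessKerAt_add (ctr 4 Lc) Lc κ ((Lc : ℤ) • w + e) ((Lc : ℤ) • fun i => (M' i : ℤ) * n i) (ξ, translate M x (-n)) (ξ', translate M z (-n)),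
    smul_translate_add]
  congr 1
  · exact Prod.ext rfl (translate_neg_add_smul_smul n hM x).symm
  · exact Prod.ext rfl (translate_neg_add_smul_smul n hM z).symm

omit [NeZero Lc] in
/-- [folklore] (TOP STOREY, roots) the root site of a level-1 block of the COPY is the period translate of the original's: `Lc•(Lc•(w+M′∘n)+e) + ρ_c = (Lc•(Lc•w+e) + ρ_c) + M∘n`. -/
theorem root_copy (hM : ∀ i, M i = Lc ^ 2 * M' i) (e : Site (3 + 1)) :
    (Lc : ℤ) • ((Lc : ℤ) • translate M' w n + e) + ctr 4 Lc = translate M ((Lc : ℤ) • ((Lc : ℤ) • w + e) + ctr 4 Lc) n := by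
  rw [translate_eq_add_smul hM, translate_eq_add]
  funext i
  simp only [Pi.add_apply, Pi.smul_apply, smul_eq_mul, Nat.cast_pow]
  ring

end Copies

/-! ## §6 Windows of the bricks on the fine lattice; the double period sum of a two-window function is a finite double sum -/

section Windows

omit [NeZero Lc] in
/-- [folklore] a fine site outside the union of the `Near` windows of the level-1 blocks of the window of `y` is outside each of them. -/
theorem not_near_of_not_mem_window₂ {L : ℕ} {y x : Site (3 + 1)}
    (hx : x ∉ (offs L).biUnion fun e => (offs L).image fun e' => (L : ℤ) • ((L : ℤ) • y + e) + e') {e : Site (3 + 1)} (he : e ∈ offs L) :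
    ¬ Near L ((L : ℤ) • y + e) x := fun hn => hx (by
  obtain ⟨e', he', rfl⟩ := near_iff_exists_offs.1 hn
  exact Finset.mem_biUnion.2 ⟨e, he, Finset.mem_image.2 ⟨e', he', rfl⟩⟩)

/-- [folklore] **A DOUBLE PERIOD SUM OF A TWO-WINDOW FUNCTION IS A FINITE DOUBLE SUM, DECOUPLED**: if `F x′ z′` vanishes unless the period index of `x′ = x + M∘n` lies in `Nx`
and that of `z′ = z + M∘k` in `Nz`, then `Σ'_m Σ'_n F (x + M∘n) (z + M∘m + M∘n) = Σ_{n ∈ Nx} Σ_{k ∈ Nz} F (x + M∘n) (z + M∘k)` (inner sum finite, `k = m + n`). -/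
theorem tsum_tsum_translate_eq_sum_sum {d : ℕ} (M : Fin (d + 1) → ℕ) (F : Site (d + 1) → Site (d + 1) → ℝ) (x z : Site (d + 1)) (Nx Nz : Finset (Site (d + 1)))
    (hNx : ∀ n ∉ Nx, ∀ z', F (translate M x n) z' = 0) (hNz : ∀ k ∉ Nz, ∀ x', F x' (translate M z k) = 0) :
    ∑' m : Site (d + 1), ∑' n : Site (d + 1), F (translate M x n) (translate M (translate M z m) n)
      = ∑ n ∈ Nx, ∑ k ∈ Nz, F (translate M x n) (translate M z k) := by
  have inner : ∀ m : Site (d + 1), (∑' n : Site (d + 1), F (translate M x n) (translate M (translate M z m) n))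
      = ∑ n ∈ Nx, F (translate M x n) (translate M z (m + n)) := fun m => by
    rw [tsum_eq_sum (s := Nx) fun n hn => hNx n hn _]
    exact Finset.sum_congr rfl fun n _ => by rw [translate_translate]
  simp only [inner]
  have hsm : ∀ n : Site (d + 1), Summable fun m : Site (d + 1) => F (translate M x n) (translate M z (m + n)) := fun n =>
    summable_of_ne_finset_zero (s := Nz.image fun k => k - n) fun m hm =>
      hNz (m + n) (fun hk => hm (Finset.mem_image.2 ⟨m + n, hk, add_sub_cancel_right m n⟩)) _
  rw [Summable.tsum_finsetSum fun n _ => hsm n]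
  refine Finset.sum_congr rfl fun n _ => ?_
  have e := (Equiv.addRight n).tsum_eq fun k => F (translate M x n) (translate M z k)
  simp only [Equiv.coe_addRight] at e
  rw [e]
  exact tsum_eq_sum fun k hk => hNz k hk _

end Windows

end Summit.QuantumFields.BalabanUV.Beta.CombMixedT2EvenStoreyTwoCopies

end
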